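import Summits.CriticalPhenomena.PercolationContinuityZ3.Theorems.PercNearOneGluingNoHeavyLowerTailForestRayleighDispatchThree
import HarnessLib

/-!
# Weighted forest negative correlation on graphs of tree-width ≤ 2 — IX: the theorem

**Theorem (Semple–Welsh 2008, Prop. 3.7 / Thm. 4.2 / Thm. 4.4, for graphs; kernel form).** Let
`T ⊆ Sym2 V` be an edge system admitting a map `ρ : V → ℕ` such that adjacent vertices get
different values, every vertex has at most two `ρ`-higher `T`-neighbours, and any two
`ρ`-higher neighbours of a vertex are `T`-adjacent — i.e. `ρ` is a perfect elimination ordering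
of a chordal graph `T` with clique number `≤ 3`; every simple graph of tree-width `≤ 2`
(equivalently, with no `K₄` minor: a series–parallel graph together with its subgraphs) lies in
such a `T` on the same vertex set. Then for all nonnegative activities `w`, all disjoint
`D, K ⊆ T` and all `e ≠ f` in `T ∖ (D ∪ K)` the weighted spanning-forest partition functions
`Z(D;K) = Σ_{G ⊆ D, ⟨G ∪ K⟩ acyclic} ∏_{g∈G} w g` satisfy the Rayleigh inequality

  `Z(D;K ∪ {e,f}) · Z(D;K) ≤ Z(D;K ∪ {e}) · Z(D;K ∪ {f})`,

i.e. the cycle matroid of every minor `⟨D ∪ K ∪ {e,f}⟩/K` is *independence correlated*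
(weighted negative correlation of `e ∈ F`, `f ∈ F` for the weighted random spanning forest =
arboreal gas; the Kahn / Grimmett–Winkler conjecture for this class, with weights).

Proof: induction on the number of edges of the instance; the `ρ`-minimal vertex of the instance
has degree `≤ 2` in it with chord in `T`, and is eliminated by `step_pendant` / `step_series_e` /
`step_series_two` (`…ForestRayleighDispatch*`). Theorems only; no definitions, no `sorry`.
-/

open Finset SimpleGraph
open scoped Classical

namespace Summit.CriticalPhenomena.PercolationContinuityZ3.Theorems.ForestRayleigh

variable {V : Type*} [Fintype V] [DecidableEq V]

/-- **Weighted forest Rayleigh inequality (independence correlation) on graphs of tree-width ≤ 2**,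
in pinned form: for `T` with an elimination order `ρ` as described in the module docstring, all
activities `w ≥ 0`, disjoint `D, K` and `e ≠ f` outside `D ∪ K` with `D ∪ K ∪ {e,f} ⊆ T`,
`Z(D;K∪{e,f})·Z(D;K) ≤ Z(D;K∪e)·Z(D;K∪f)`. [Semple–Welsh, CPC 17 (2008), Prop. 3.7 & Thm. 4.2,
graphic case; proof by elimination of a vertex of degree ≤ 2] -/
theorem forestsW_rayleigh_of_elimOrder (T : Finset (Sym2 V)) (ρ : V → ℕ)
    (hρ : ∀ u v : V, s(u, v) ∈ T → ρ u ≠ ρ v)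
    (h2 : ∀ v u₁ u₂ u₃ : V, s(v, u₁) ∈ T → s(v, u₂) ∈ T → s(v, u₃) ∈ T →
      ρ v < ρ u₁ → ρ v < ρ u₂ → ρ v < ρ u₃ → u₁ = u₂ ∨ u₁ = u₃ ∨ u₂ = u₃)
    (hfill : ∀ v u₁ u₂ : V, s(v, u₁) ∈ T → s(v, u₂) ∈ T → ρ v < ρ u₁ → ρ v < ρ u₂ →
      u₁ ≠ u₂ → s(u₁, u₂) ∈ T)
    (w : Sym2 V → ℝ) (hw : ∀ x, 0 ≤ w x) (D K : Finset (Sym2 V)) (e f : Sym2 V)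
    (hsub : D ∪ insert e (insert f K) ⊆ T) (hDK : Disjoint D K) (heD : e ∉ D) (heK : e ∉ K)
    (hfD : f ∉ D) (hfK : f ∉ K) (hef : e ≠ f) :
    (∑ G ∈ D.powerset.filter (fun G =>
        (fromEdgeSet ((G ∪ (insert e (insert f K)) : Finset (Sym2 V)) : Set (Sym2 V))).IsAcyclic), ∏ x ∈ G, w x) *
      (∑ G ∈ D.powerset.filter (fun G =>
        (fromEdgeSet ((G ∪ K : Finset (Sym2 V)) : Set (Sym2 V))).IsAcyclic), ∏ x ∈ G, w x) ≤
    (∑ G ∈ D.powerset.filter (fun G =>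
        (fromEdgeSet ((G ∪ (insert e K) : Finset (Sym2 V)) : Set (Sym2 V))).IsAcyclic), ∏ x ∈ G, w x) *
      (∑ G ∈ D.powerset.filter (fun G =>
        (fromEdgeSet ((G ∪ (insert f K) : Finset (Sym2 V)) : Set (Sym2 V))).IsAcyclic), ∏ x ∈ G, w x) := by
  have hT : ∀ x ∈ T, ¬x.IsDiag :=
    Sym2.ind (fun a b hab hd => hρ a b hab (congrArg ρ (Sym2.mk_isDiag_iff.1 hd)))
  obtain ⟨n, hn⟩ : ∃ n, (D ∪ insert e (insert f K)).card = n := ⟨_, rfl⟩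
  induction n using Nat.strong_induction_on generalizing w D K e f with
  | _ n ihn =>
  -- the packaged induction hypothesis
  have ih : ∀ (w' : Sym2 V → ℝ), (∀ x, 0 ≤ w' x) → ∀ (D' K' : Finset (Sym2 V)) (e' f' : Sym2 V),
      (D' ∪ insert e' (insert f' K')).card < (D ∪ insert e (insert f K)).card →
      D' ∪ insert e' (insert f' K') ⊆ T → Disjoint D' K' → e' ∉ D' → e' ∉ K' → f' ∉ D' →
      f' ∉ K' → e' ≠ f' →
      (∑ G ∈ D'.powerset.filter (fun G =>
        (fromEdgeSet ((G ∪ (insert e' (insert f' K')) : Finset (Sym2 V)) : Set (Sym2 V))).IsAcyclic), ∏ x ∈ G, w' x) *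
      (∑ G ∈ D'.powerset.filter (fun G =>
        (fromEdgeSet ((G ∪ K' : Finset (Sym2 V)) : Set (Sym2 V))).IsAcyclic), ∏ x ∈ G, w' x) ≤
    (∑ G ∈ D'.powerset.filter (fun G =>
        (fromEdgeSet ((G ∪ (insert e' K') : Finset (Sym2 V)) : Set (Sym2 V))).IsAcyclic), ∏ x ∈ G, w' x) *
      (∑ G ∈ D'.powerset.filter (fun G =>
        (fromEdgeSet ((G ∪ (insert f' K') : Finset (Sym2 V)) : Set (Sym2 V))).IsAcyclic), ∏ x ∈ G, w' x) :=
    fun w' hw' D' K' e' f' hlt hs hd h₁ h₂ h₃ h₄ h₅ =>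
      ihn _ (hn ▸ hlt) w' hw' D' K' e' f' hs hd h₁ h₂ h₃ h₄ h₅ rfl
  have heE : e ∈ D ∪ insert e (insert f K) := by simp
  have hfE : f ∈ D ∪ insert e (insert f K) := by simp
  -- the vertices of the instance and a `ρ`-minimal one
  obtain ⟨S, hS⟩ : ∃ S : Finset V, ∀ x, x ∈ S ↔ ∃ z ∈ D ∪ insert e (insert f K), x ∈ z :=
    ⟨Finset.univ.filter (fun x => ∃ z ∈ D ∪ insert e (insert f K), x ∈ z), fun x => by simp⟩
  have hSne : S.Nonempty := ⟨e.out.1, (hS _).2 ⟨e, heE, Sym2.out_fst_mem e⟩⟩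
  obtain ⟨v, hvS, hvmin⟩ := Finset.exists_min_image S ρ hSne
  obtain ⟨z, hzE, hvz⟩ := (hS v).1 hvS
  obtain ⟨u₁, hg₁⟩ : ∃ u₁, s(v, u₁) ∈ D ∪ insert e (insert f K) :=
    ⟨Sym2.Mem.other hvz, by rw [Sym2.other_spec hvz]; exact hzE⟩
  have hup : ∀ u, s(v, u) ∈ D ∪ insert e (insert f K) → ρ v < ρ u := fun u hu =>
    lt_of_le_of_ne (hvmin u ((hS u).2 ⟨_, hu, Sym2.mem_mk_right v u⟩)) (hρ v u (hsub hu))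
  by_cases hex : ∃ u₂, u₂ ≠ u₁ ∧ s(v, u₂) ∈ D ∪ insert e (insert f K)
  · -- `v` has exactly two neighbours `u₁, u₂`, and the chord lies in `T`
    obtain ⟨u₂, hu₂₁, hg₂⟩ := hex
    have honly : ∀ z ∈ D ∪ insert e (insert f K), v ∈ z → z = s(v, u₁) ∨ z = s(v, u₂) := by
      intro z' hz' hvz'
      have e' := Sym2.other_spec hvz'
      have hm : s(v, Sym2.Mem.other hvz') ∈ D ∪ insert e (insert f K) := by rw [e']; exact hz'
      rcases h2 v u₁ u₂ (Sym2.Mem.other hvz') (hsub hg₁) (hsub hg₂) (hsub hm) (hup _ hg₁)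
        (hup _ hg₂) (hup _ hm) with hh | hh | hh
      · exact absurd hh hu₂₁.symm
      · exact Or.inl (by rw [← e', ← hh])
      · exact Or.inr (by rw [← e', ← hh])
    have honly' : ∀ z ∈ D ∪ insert e (insert f K), v ∈ z → z = s(v, u₂) ∨ z = s(v, u₁) :=
      fun z' hz' hvz' => (honly z' hz' hvz').symm
    have hhT : s(u₁, u₂) ∈ T :=
      hfill v u₁ u₂ (hsub hg₁) (hsub hg₂) (hup _ hg₁) (hup _ hg₂) hu₂₁.symm
    have hhT' : s(u₂, u₁) ∈ T := by rw [Sym2.eq_swap]; exact hhT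
    have hg₂₁ : s(v, u₂) ≠ s(v, u₁) := fun hh => hu₂₁ (Sym2.congr_right.1 hh)
    by_cases hve : v ∈ e
    · rcases honly e heE hve with he | he
      · subst he
        refine step_series_e T hT w hw D K f hsub hDK heD heK hfD hfK hef hu₂₁.symm ?_ honly hhT ih
        simp only [Finset.mem_union, Finset.mem_insert] at hg₂ ⊢
        rcases hg₂ with hh | hh | hh | hh
        · exact Or.inl hh
        · exact absurd hh hg₂₁
        · exact Or.inr (Or.inl hh)
        · exact Or.inr (Or.inr hh)
      · subst he
        refine step_series_e T hT w hw D K f hsub hDK heD heK hfD hfK hef hu₂₁ ?_ honly' hhT' ih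
        simp only [Finset.mem_union, Finset.mem_insert] at hg₁ ⊢
        rcases hg₁ with hh | hh | hh | hh
        · exact Or.inl hh
        · exact absurd hh hg₂₁.symm
        · exact Or.inr (Or.inl hh)
        · exact Or.inr (Or.inr hh)
    by_cases hvf : v ∈ f
    · have hsub' : D ∪ insert f (insert e K) ⊆ T := by rw [Finset.insert_comm]; exact hsub
      have ih' : ∀ (w' : Sym2 V → ℝ), (∀ x, 0 ≤ w' x) → ∀ (D' K' : Finset (Sym2 V)) (e' f' : Sym2 V),
      (D' ∪ insert e' (insert f' K')).card < (D ∪ insert f (insert e K)).card →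
      D' ∪ insert e' (insert f' K') ⊆ T → Disjoint D' K' → e' ∉ D' → e' ∉ K' → f' ∉ D' →
      f' ∉ K' → e' ≠ f' →
      (∑ G ∈ D'.powerset.filter (fun G =>
        (fromEdgeSet ((G ∪ (insert e' (insert f' K')) : Finset (Sym2 V)) : Set (Sym2 V))).IsAcyclic), ∏ x ∈ G, w' x) *
      (∑ G ∈ D'.powerset.filter (fun G =>
        (fromEdgeSet ((G ∪ K' : Finset (Sym2 V)) : Set (Sym2 V))).IsAcyclic), ∏ x ∈ G, w' x) ≤
    (∑ G ∈ D'.powerset.filter (fun G =>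
        (fromEdgeSet ((G ∪ (insert e' K') : Finset (Sym2 V)) : Set (Sym2 V))).IsAcyclic), ∏ x ∈ G, w' x) *
      (∑ G ∈ D'.powerset.filter (fun G =>
        (fromEdgeSet ((G ∪ (insert f' K') : Finset (Sym2 V)) : Set (Sym2 V))).IsAcyclic), ∏ x ∈ G, w' x) := by
        rw [Finset.insert_comm f e K]; exact ih
      rcases honly f hfE hvf with hf | hf
      · subst hf
        refine lsm_symm w D K e _ (step_series_e T hT w hw D K e hsub' hDK hfD hfK heD heK hef.symm
          hu₂₁.symm ?_ (fun z' hz' hvz' => honly z' (by rw [Finset.insert_comm]; exact hz') hvz')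
          hhT ih')
        simp only [Finset.mem_union, Finset.mem_insert] at hg₂ ⊢
        rcases hg₂ with hh | hh | hh | hh
        · exact Or.inl hh
        · exact Or.inr (Or.inl hh)
        · exact absurd hh hg₂₁
        · exact Or.inr (Or.inr hh)
      · subst hf
        refine lsm_symm w D K e _ (step_series_e T hT w hw D K e hsub' hDK hfD hfK heD heK hef.symm
          hu₂₁ ?_ (fun z' hz' hvz' => honly' z' (by rw [Finset.insert_comm]; exact hz') hvz')
          hhT' ih')
        simp only [Finset.mem_union, Finset.mem_insert] at hg₁ ⊢
        rcases hg₁ with hh | hh | hh | hh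
        · exact Or.inl hh
        · exact Or.inr (Or.inl hh)
        · exact absurd hh hg₂₁.symm
        · exact Or.inr (Or.inr hh)
    -- both edges of `v` lie in `D ∪ K`
    have hDK₁ : s(v, u₁) ∈ D ∪ K := by
      simp only [Finset.mem_union, Finset.mem_insert] at hg₁ ⊢
      rcases hg₁ with hh | hh | hh | hh
      · exact Or.inl hh
      · exact absurd (hh ▸ Sym2.mem_mk_left v u₁) hve
      · exact absurd (hh ▸ Sym2.mem_mk_left v u₁) hvf
      · exact Or.inr hh
    have hDK₂ : s(v, u₂) ∈ D ∪ K := by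
      simp only [Finset.mem_union, Finset.mem_insert] at hg₂ ⊢
      rcases hg₂ with hh | hh | hh | hh
      · exact Or.inl hh
      · exact absurd (hh ▸ Sym2.mem_mk_left v u₂) hve
      · exact absurd (hh ▸ Sym2.mem_mk_left v u₂) hvf
      · exact Or.inr hh
    exact step_series_two T hT w hw D K e f hsub hDK heD heK hfD hfK hef hu₂₁.symm honly hhT hDK₁
      hDK₂ ih
  · -- `v` is pendant
    have honly : ∀ z ∈ D ∪ insert e (insert f K), v ∈ z → z = s(v, u₁) := by
      intro z' hz' hvz'
      have e' := Sym2.other_spec hvz'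
      have hm : s(v, Sym2.Mem.other hvz') ∈ D ∪ insert e (insert f K) := by rw [e']; exact hz'
      by_contra hne
      refine hex ⟨Sym2.Mem.other hvz', fun hh => hne ?_, hm⟩
      rw [← e', hh]
    exact step_pendant T hT w hw D K e f hsub hDK heD heK hfD hfK hef hg₁ honly ih


end Summit.CriticalPhenomena.PercolationContinuityZ3.Theorems.ForestRayleigh
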